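import Summits.CriticalPhenomena.SAWScalingLimit.Theorems.SAWReversalUpgradeAttachNoReturnEventually
import Literature.Barriers.CriticalPhenomena.SupercriticalSAWSpaceFillingReversible
import HarnessLib

/-!
# Route `SAWReversalUpgrade`: the support `AttachNoReturn` (stmt-CriticalPhenomena-18057), proved

`Summit.CriticalPhenomena.SAWScalingLimit.Theses.SAWReversalUpgrade.AttachNoReturn`: endpoint
tightness passes from the critical SAW to its canonically boundary-attached curve. Under
"no deep return to `a`" for the SAW polyline in `(D; a, b)` and the same for the SAW of the swapped
domain `(D.swap; b, a)`, every eventually-standard attachment `att` satisfies, for all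
`ε, η > 0`, for some `r > 0` and all small `δ`:

* (H6) the SAW law gives mass `≤ η` to `{γ | att γ is ε-far from a and later r-close to a}`;
* (H7) the SAW law gives mass `≤ η` to `{γ | att γ is r-close to b and later ε-far from b}`.

Proof: by `AttachNoReturn.eventually_event_pt_zero` the (H6)-event is contained, for small `δ`,
in the polyline event with parameters `(ε/2, r₀)` whose mass the first hypothesis bounds; by
`AttachNoReturn.eventually_event_pt_one` the (H7)-event is contained in the `(ε/2, r₀)` deep-return
event of the REVERSED walk at `b`, whose law is the SAW law of `(D.swap; b, a)` by the exact
reversal symmetry `x_c^{|γ^R|} = x_c^{|γ|}` (`SupercriticalSAW.lawAt_map_sawReverse`), bounded by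
the second hypothesis. The geometric work (traversal order of the attached arc, Carathéodory
continuity, smallness of the access segment / exit ray / squeeze displacement, flatness of the
lattice polyline, the fallback geodesic) is in the helper files
`SAWReversalUpgradeAttachNoReturn{Arc,Order,Polyline,Pieces,Structure,Events,Fallback,Eventually}`.
-/

noncomputable section

open Set Filter Metric Function MeasureTheory
open scoped Topology unitInterval ENNReal
open UpperHalfPlane (upperHalfPlaneSet)
open Literature.Probability.RandomPlanarGeometry Literature.Probability.LatticeModels
open Literature.Probability.RandomPlanarGeometry.SAW
open Literature.Barriers.CriticalPhenomena

namespace Summit.CriticalPhenomena.SAWScalingLimit.Theorems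

open AttachReversal AttachNoReturn

/-- **`AttachNoReturn` (route `SAWReversalUpgrade`, stmt-CriticalPhenomena-18057).** Endpoint
tightness of the critical SAW (no deep return to `a`; no deep return to `b = D.swap.pt 0` for the
swapped domain) passes to every eventually-standard boundary attachment: (H6) no deep return of
`att γ` to `a`, (H7) no escape of `att γ` from `b` after a close approach, with probability
`≥ 1 - η` for small mesh. -/
theorem attachNoReturn_proof : Theses.SAWReversalUpgrade.AttachNoReturn := by
  intro D A B hAB φ hφ att hatt hHa hHb
  have hstd : ∀ᶠ δ in 𝓝[>] (0 : ℝ), ∀ γ : DomainSAW D.carrier δ (A δ) (B δ),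
      att δ γ ∈ standardCurves (D.pt 0) (D.pt 1) φ.boundaryExtension (min δ (1 / 2))
        (projLine (γ.walk.toCurve (meshPoint δ))) D.carrier := hatt
  constructor
  · -- (H6): deep returns of `att γ` to `a` are deep returns of `γ`
    intro ε hε η hη
    obtain ⟨r₀, hr₀, hlaw⟩ := hHa (ε / 2) (half_pos hε) η hη
    obtain ⟨r, hr, hev⟩ := eventually_event_pt_zero hAB hφ hstd hε hr₀
    refine ⟨r, hr, ?_⟩
    filter_upwards [hlaw, hev] with δ h1 h2
    refine le_trans (measure_mono ?_) h1
    rintro γ ⟨s, t, hst, hfar, hnear⟩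
    exact h2 γ s t hst hfar hnear
  · -- (H7): escapes of `att γ` from `b` are deep returns of the reversed walk to `b`
    intro ε hε η hη
    obtain ⟨r₀, hr₀, hlaw⟩ := hHb (ε / 2) (half_pos hε) η hη
    obtain ⟨r, hr, hev⟩ := eventually_event_pt_one hAB hφ hstd hε hr₀
    refine ⟨r, hr, ?_⟩
    filter_upwards [hlaw, hev] with δ h1 h2
    simp only [MarkedDomain.pt_swap_zero] at h1
    -- the deep-return event of the reversed walk at `b`
    set E' : Set (DomainSAW D.carrier δ (B δ) (A δ)) := {γ' | ∃ s t : I, s < t ∧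
      ε / 2 ≤ dist (γ'.walk.toCurve (meshPoint δ) s) (D.pt 1) ∧
      dist (γ'.walk.toCurve (meshPoint δ) t) (D.pt 1) ≤ r₀} with hE'
    have hmap : (law D.carrier δ (A δ) (B δ)).map SupercriticalSAW.sawReverse =
        law D.carrier δ (B δ) (A δ) :=
      SupercriticalSAW.lawAt_map_sawReverse criticalFugacity D.carrier δ (A δ) (B δ)
    calc law D.carrier δ (A δ) (B δ) {γ | ∃ s t : I, s < t ∧ dist (att δ γ s) (D.pt 1) ≤ r ∧
          ε ≤ dist (att δ γ t) (D.pt 1)}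
        ≤ law D.carrier δ (A δ) (B δ) (SupercriticalSAW.sawReverse ⁻¹' E') := by
          refine measure_mono ?_
          rintro γ ⟨s, t, hst, hnear, hfar⟩
          exact h2 γ s t hst hnear hfar
      _ = (law D.carrier δ (A δ) (B δ)).map SupercriticalSAW.sawReverse E' :=
          (Measure.map_apply (DomainSAW.measurable_of_top _) MeasurableSpace.measurableSet_top).symm
      _ = law D.carrier δ (B δ) (A δ) E' := by rw [hmap]
      _ ≤ ENNReal.ofReal η := h1

end Summit.CriticalPhenomena.SAWScalingLimit.Theorems
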